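import Summits.AtomisticToContinuum.HydrodynamicLimit.Theses.JeansLoadedDice
import Summits.AtomisticToContinuum.HydrodynamicLimit.Theses.SpeedCapSurgery
import Summits.AtomisticToContinuum.HydrodynamicLimit.Theorems.OneFlightGossipEngineEnergyCurrentTailsRungHalfLawDomination
import Summits.AtomisticToContinuum.HydrodynamicLimit.Theorems.OneFlightGossipEngineEnergyCurrentTailsRungHalfTubeMeanLower
import Summits.AtomisticToContinuum.HydrodynamicLimit.Theorems.OneFlightGossipEngineEnergyCurrentTailsRungHalfHotSpot
import Summits.AtomisticToContinuum.HydrodynamicLimit.Theorems.OneFlightGossipEngineEnergyCurrentTailsRungHalfRhsShortTime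
import Summits.AtomisticToContinuum.HydrodynamicLimit.Theorems.OneFlightGossipEngineEnergyCurrentTailsRungHalfCollisionCount
import Summits.AtomisticToContinuum.HydrodynamicLimit.Theorems.OneFlightGossipEngineEnergyCurrentTailsRungHalfPathwise
import Summits.AtomisticToContinuum.HydrodynamicLimit.Theorems.OneFlightGossipEngineEnergyCurrentTailsLevelCensusSplitFloorRung0Statics
import Literature.MathematicalPhysics.KineticTheory.CollisionTubePairMeanLowerBound
import Literature.MathematicalPhysics.KineticTheory.HardSphereEulerProofs
import Literature.MathematicalPhysics.KineticTheory.HardSphereCanonicalTorus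
import Literature.MathematicalPhysics.KineticTheory.HardSphereTwoTimePressure
import Literature.Analysis.FluidPDE.HardSphereAlexander
import HarnessLib

/-!
# Refutation of `JeansLoadedDice.ContactIntensityDomination` (item stmt-AtomisticToContinuum-9218)
# — rung ½ of the crux `EnergyCurrentTails` (stmt-AtomisticToContinuum-9235, line `level-census-comparison`, seat c4)

`ContactIntensityDomination` (shared verbatim with the retired `AprioriTailsRattlers.ContactIntensityDomination`; registered as the
stub `stub_contactIntensityDomination` of the crux stmt-9235 by seat a1) asserts a ONE-SIDED STOSSZAHLANSATZ CEILING that is UNIFORM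
OVER ALL CONTINUOUS MARKS `φ`: for all continuous positive profiles there is `σ₀` such that for `σ < σ₀`, `T > 0` and every flow
family, `∃ C < ⊤ ∃ N₀ ∀ N ≥ N₀ ∀ 0 ≤ s ≤ t ≤ T ∀ φ`, the expected collision sum of `φ(vᵢ⁻, vⱼ⁻)` over `(s,t]` is at most
`C σ²(N+1)^{1/3}/(N+1) ∫_s^t E⊗E[Σᵢⱼ φ(vᵢ, v′ⱼ)‖vᵢ − v′ⱼ‖]` — the product of two INDEPENDENT copies of the law, i.e. of the
SPATIALLY AVERAGED one-particle velocity laws.  It is FALSE as typed [refuted-misstated]: at contact the pair's velocity law is a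
mixture over the macroscopic position `x` of products `M_{θ(x)} ⊗ M_{θ(x)}`, and a mixture of products is not dominated by a
constant times the product of the mixtures in the joint tail when the temperature profile has a strict maximum (hot spot).

WITNESS (rung ½ = inhomogeneous local Gibbs data, `s = 0`, `t = h → 0`, then `N → ∞`): activity `a₀ ≡ 1`, drift `u₀ ≡ 0`,
temperature `θhot x = 2 − ‖x‖` on `𝕋³` (`‖x‖ ≤ 1/2`, so `θhot ∈ [3/2, 2]` with its unique maximum at `x = 0`); marks
`φ_V(v,w) = β(v − Ve₁)β(w + Ve₁) + β(w − Ve₁)β(v + Ve₁)`, `β = (1 − ‖·‖)₊`.  With `G_V θ = ∫ β(v − Ve₁) dN(0,θ)`: the left-hand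
side over `(0,h]` is `≥ (N+1)N(1−16λ)ε_N² h (πV/4) ∫ G_V(θhot x)² dx − O_N(h²)` (static main term: inhomogeneous pair tube mean
`stub_tubeMeanLower`; pathwise transfer `stub_pathwiseLower`; pair-excess statics via `splitFloorRung0_statics` and the law domination
`stub_lawDomination`), the right-hand side is `≤ C ε_N² · 2(2V+2) h (2(N+1)∫G_V(θhot x)dx + O_N(h))²` (`stub_rhsShortTime`,
`stub_collisionCountShortTime`), and `∫ G_V(θhot)² / (∫ G_V(θhot))² → ∞` as `V → ∞` (`stub_hotSpotDivergence`); letting `h → 0` gives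
`(1−16λ)π ∫G² ≤ 192 C.toReal (∫G)²`, a contradiction for `V` large.  The flow family is Alexander's (`HardSphereFlow.nonempty_torus_holds`).

REPAIRED STATEMENT (what the producers F1 `RateCeiling`, S2a `stub_energyFluxCeiling`, `MeanCollisionalImpulseBound` actually need, and
what passes rung ½): the LOCAL form — the same ceiling with the one-copy mollified Enskog pair functional
`∫dτ E[Σ_{i≠j} φ(vᵢ,vⱼ)‖vᵢ−vⱼ‖ b_r(xᵢ − xⱼ)]/‖b_r‖₁` on the right (one-sided molecular chaos `f₂(x,v,x⁺,w) ≤ C f₁(x,v) f₁(x,w)` in `L¹`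
against the kernel) — or the restriction to ONE-RARE-PARTICIPANT marks `φ(v,w) ≤ ψ(v)(1+‖w‖ᵏ) + ψ(w)(1+‖v‖ᵏ)`.  The witness misses both.
-/
namespace Summit.AtomisticToContinuum.HydrodynamicLimit.Theses.JeansLoadedDice
open scoped BigOperators Topology Manifold Classical MeasureTheory ProbabilityTheory Matrix InnerProductSpace ComplexConjugate ContinuousMap in
open Filter Set Function TopologicalSpace MeasureTheory in
open Literature.Analysis.FluidPDE Literature.MathematicalPhysics.KineticTheory in
/-- Record of the dropped route item `ContactIntensityDomination` = stmt-AtomisticToContinuum-9218 (ledger signature verbatim; NOT a route item;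
dropped from routes JeansLoadedDice/SpeedCapSurgery 2026-08-17), re-created so this accepted refutation keeps elaborating (buildfix 2026-08-19). -/
def ContactIntensityDomination : Prop :=
  ∀ (a₀ θ₀ : Literature.MathematicalPhysics.KineticTheory.T3 → ℝ) (u₀ : Literature.MathematicalPhysics.KineticTheory.T3 → Literature.MathematicalPhysics.KineticTheory.V3), Continuous a₀ → Continuous θ₀ → Continuous u₀ → (∀ x, 0 < a₀ x) → (∀ x, 0 < θ₀ x) → ∃ σ₀ : ℝ, 0 < σ₀ ∧ ∀ σ : ℝ, 0 < σ → σ < σ₀ → ∀ T : ℝ, 0 < T → ∀ Φ : ((N : ℕ) → Literature.Analysis.FluidPDE.HardSphereFlow (Literature.Analysis.FluidPDE.Torus.geometry (Fin 3)) (Literature.MathematicalPhysics.KineticTheory.hsDiameter σ N) (N + 1)), ∃ C : ENNReal, C < ⊤ ∧ ∃ N₀ : ℕ, ∀ N : ℕ, N₀ ≤ N → ∀ s t : ℝ, 0 ≤ s → s ≤ t → t ≤ T → ∀ φ : Literature.MathematicalPhysics.KineticTheory.V3 × Literature.MathematicalPhysics.KineticTheory.V3 → ENNReal, Continuous φ →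 (∫⁻ z, (∑ᶠ τ ∈ Literature.Analysis.FluidPDE.collisionTimes (Literature.Analysis.FluidPDE.Torus.geometry (Fin 3)) (Literature.MathematicalPhysics.KineticTheory.hsDiameter σ N) (fun r => (Φ N).flow r z) ∩ Set.Ioc s t, ∑ i : Fin (N + 1), ∑ j : Fin (N + 1), if i = j then (0 : ENNReal) else (Literature.Analysis.FluidPDE.contactSet (Literature.Analysis.FluidPDE.Torus.geometry (Fin 3)) (N + 1) (Literature.MathematicalPhysics.KineticTheory.hsDiameter σ N) i j).indicator (fun y => φ ((((Literature.Analysis.FluidPDE.collidePair (Literature.Analysis.FluidPDE.Torus.geometry (Fin 3)) i j y)) i).2, (((Literature.Analysis.FluidPDE.collidePair (Literature.Analysis.FluidPDE.Torus.geometry (Fin 3)) i j y)) j).2)) ((Φ N).flow τ z)) ∂(Literature.MathematicalPhysics.KineticTheory.localGibbsLaw σ a₀ u₀ θ₀ N (Φ N))) ≤ C * ENNReal.ofReal ((σ ^ 2 * ((N + 1 : ℕ) : ℝ) ^ ((1 : ℝ) / 3)) / ((N + 1 : ℕ) : ℝ)) * ∫⁻ τ in Set.Ioc s t, (∫⁻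 z, ∫⁻ z', (∑ i : Fin (N + 1), ∑ j : Fin (N + 1), φ (((((Φ N).flow τ z)) i).2, ((((Φ N).flow τ z')) j).2) * ENNReal.ofReal ‖((((Φ N).flow τ z)) i).2 - ((((Φ N).flow τ z')) j).2‖) ∂(Literature.MathematicalPhysics.KineticTheory.localGibbsLaw σ a₀ u₀ θ₀ N (Φ N)) ∂(Literature.MathematicalPhysics.KineticTheory.localGibbsLaw σ a₀ u₀ θ₀ N (Φ N)))
end Summit.AtomisticToContinuum.HydrodynamicLimit.Theses.JeansLoadedDice

namespace Summit.AtomisticToContinuum.HydrodynamicLimit.Theses.SpeedCapSurgery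
open scoped BigOperators Topology Manifold Classical MeasureTheory ProbabilityTheory Matrix InnerProductSpace ComplexConjugate ContinuousMap in
open Filter Set Function TopologicalSpace MeasureTheory in
/-- Record of the dropped route item `ContactIntensityDomination` = stmt-AtomisticToContinuum-9218 (ledger signature verbatim; NOT a route item;
dropped from routes JeansLoadedDice/SpeedCapSurgery 2026-08-17), re-created so this accepted refutation keeps elaborating (buildfix 2026-08-19). -/
def ContactIntensityDomination : Prop :=
  ∀ (a₀ θ₀ : Literature.MathematicalPhysics.KineticTheory.T3 → ℝ) (u₀ : Literature.MathematicalPhysics.KineticTheory.T3 → Literature.MathematicalPhysics.KineticTheory.V3), Continuous a₀ → Continuous θ₀ → Continuous u₀ → (∀ x, 0 < a₀ x) → (∀ x, 0 < θ₀ x) → ∃ σ₀ : ℝ, 0 < σ₀ ∧ ∀ σ : ℝ, 0 < σ → σ < σ₀ → ∀ T : ℝ, 0 < T → ∀ Φ : ((N : ℕ) → Literature.Analysis.FluidPDE.HardSphereFlow (Literature.Analysis.FluidPDE.Torus.geometry (Fin 3)) (Literature.MathematicalPhysics.KineticTheory.hsDiameter σ N) (N + 1)), ∃ C : ENNReal,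 C < ⊤ ∧ ∃ N₀ : ℕ, ∀ N : ℕ, N₀ ≤ N → ∀ s t : ℝ, 0 ≤ s → s ≤ t → t ≤ T → ∀ φ : Literature.MathematicalPhysics.KineticTheory.V3 × Literature.MathematicalPhysics.KineticTheory.V3 → ENNReal, Continuous φ → (∫⁻ z, (∑ᶠ τ ∈ Literature.Analysis.FluidPDE.collisionTimes (Literature.Analysis.FluidPDE.Torus.geometry (Fin 3)) (Literature.MathematicalPhysics.KineticTheory.hsDiameter σ N) (fun r => (Φ N).flow r z) ∩ Set.Ioc s t, ∑ i : Fin (N + 1), ∑ j : Fin (N + 1), if i = j then (0 : ENNReal) else (Literature.Analysis.FluidPDE.contactSet (Literature.Analysis.FluidPDE.Torus.geometry (Fin 3)) (N + 1) (Literature.MathematicalPhysics.KineticTheory.hsDiameter σ N) i j).indicator (fun y => φ ((((Literature.Analysis.FluidPDE.collidePair (Literature.Analysis.FluidPDE.Torus.geometry (Fin 3)) i j y)) i).2, (((Literature.Analysis.FluidPDE.collidePair (Literature.Analysis.FluidPDE.Torus.geometry (Fin 3)) i j y)) j).2)) ((Φ N).flow τ z)) ∂(Literature.MathematicalPhysics.KineticTheory.localGibbsLaw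 σ a₀ u₀ θ₀ N (Φ N))) ≤ C * ENNReal.ofReal ((σ ^ 2 * ((N + 1 : ℕ) : ℝ) ^ ((1 : ℝ) / 3)) / ((N + 1 : ℕ) : ℝ)) * ∫⁻ τ in Set.Ioc s t, (∫⁻ z, ∫⁻ z', (∑ i : Fin (N + 1), ∑ j : Fin (N + 1), φ (((((Φ N).flow τ z)) i).2, ((((Φ N).flow τ z')) j).2) * ENNReal.ofReal ‖((((Φ N).flow τ z)) i).2 - ((((Φ N).flow τ z')) j).2‖) ∂(Literature.MathematicalPhysics.KineticTheory.localGibbsLaw σ a₀ u₀ θ₀ N (Φ N)) ∂(Literature.MathematicalPhysics.KineticTheory.localGibbsLaw σ a₀ u₀ θ₀ N (Φ N)))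
end Summit.AtomisticToContinuum.HydrodynamicLimit.Theses.SpeedCapSurgery

noncomputable section

open MeasureTheory Set Filter
open scoped ENNReal InnerProductSpace BigOperators Classical

namespace Summit.AtomisticToContinuum.HydrodynamicLimit.Theorems.EnergyCurrentTailsRungHalf

open Literature.MathematicalPhysics.KineticTheory Literature.Analysis.FluidPDE
open Summit.AtomisticToContinuum.HydrodynamicLimit.Theorems.RateFloorLine

/-! ## The composition: the seven rung-½ stubs refute `ContactIntensityDomination` -/

section Assembly

open Topology

/-- Every point of the unit torus `𝕋³` (sup norm of the symmetric representatives) has norm `≤ 1/2`. -/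
theorem norm_T3_le_half (x : T3) : ‖x‖ ≤ 1 / 2 := by
  rw [pi_norm_le_iff_of_nonneg (by norm_num)]
  intro i
  have := AddCircle.norm_le_half_period (1 : ℝ) (x := x i)
  simpa using this

/-- The hot-spot temperature `θhot x = 2 − ‖x‖` is at least `3/2`. -/
theorem thetaHot_ge (x : T3) : (3 : ℝ) / 2 ≤ 2 - ‖x‖ := by linarith [norm_T3_le_half x]

/-- The hot-spot temperature is at most `2`. -/
theorem thetaHot_le (x : T3) : 2 - ‖x‖ ≤ (2 : ℝ) := by linarith [norm_nonneg x]

/-- The hot-spot temperature is positive. -/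
theorem thetaHot_pos (x : T3) : (0 : ℝ) < 2 - ‖x‖ := by linarith [thetaHot_ge x]

/-- The hot-spot temperature profile is continuous. -/
theorem continuous_thetaHot : Continuous fun x : T3 => (2 : ℝ) - ‖x‖ :=
  continuous_const.sub continuous_norm

/-- Choice of the reduced density: below any `σ₀ > 0` there is `σ` with all smallness conditions of the
rung-0 statics and `16 λ ≤ 1/2` (`λ = v₁ σ³`). -/
theorem exists_sigma_small {σ₀ : ℝ} (hσ₀ : 0 < σ₀) :
    ∃ σ : ℝ, 0 < σ ∧ σ < σ₀ ∧ SmallDensity uniformProfile σ ∧ 16 * ovDensity uniformProfile σ ≤ 1 / 2 := by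
  obtain ⟨σ₁, hσ₁, hsmall⟩ := exists_smallDensity uniformProfile one_pos
  have hv := v₁_pos
  set σ₂ : ℝ := min 1 (1 / (32 * v₁)) with hσ₂def
  have hσ₂ : 0 < σ₂ := lt_min one_pos (by positivity)
  set σ : ℝ := min (σ₀ / 2) (min (σ₁ / 2) σ₂) with hσdef
  have hσ : 0 < σ := lt_min (by positivity) (lt_min (by positivity) hσ₂)
  have hσσ₀ : σ < σ₀ := (min_le_left _ _).trans_lt (by linarith)
  have hσσ₁ : σ < σ₁ := ((min_le_right _ _).trans (min_le_left _ _)).trans_lt (by linarith)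
  have hσσ₂ : σ ≤ σ₂ := (min_le_right _ _).trans (min_le_right _ _)
  refine ⟨σ, hσ, hσσ₀, (hsmall σ hσ hσσ₁).1, ?_⟩
  have h1 : σ ≤ 1 := hσσ₂.trans (min_le_left _ _)
  have h2 : σ ≤ 1 / (32 * v₁) := hσσ₂.trans (min_le_right _ _)
  have h3 : σ ^ 3 ≤ σ := pow_le_of_le_one hσ.le h1 (by norm_num)
  rw [ovDensity_uniformProfile]
  have h4 : v₁ * σ ^ 3 ≤ v₁ * (1 / (32 * v₁)) :=
    mul_le_mul_of_nonneg_left (h3.trans h2) hv.le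
  rw [mul_one_div, show v₁ / (32 * v₁) = 1 / 32 by field_simp] at h4
  linarith

/-- Choice of the particle number: beyond `N₀`, at least `1`, with `ε_N (V+1)² ≤ 1/16`. -/
theorem exists_N_large (σ : ℝ) (N₀ : ℕ) (V : ℝ) :
    ∃ N : ℕ, N₀ ≤ N ∧ 1 ≤ N ∧ hsDiameter σ N * (V + 1) ^ 2 ≤ 1 / 16 := by
  have hpos : (0 : ℝ) < 1 / (16 * ((V + 1) ^ 2 + 1)) := by positivity
  have hev : ∀ᶠ N in atTop, hsDiameter σ N < 1 / (16 * ((V + 1) ^ 2 + 1)) :=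
    (tendsto_hsDiameter σ) (Iio_mem_nhds hpos)
  obtain ⟨N, hN, hN₀, hN1⟩ := (hev.and ((eventually_ge_atTop N₀).and (eventually_ge_atTop 1))).exists
  refine ⟨N, hN₀, hN1, ?_⟩
  have hsq : (0 : ℝ) ≤ (V + 1) ^ 2 := sq_nonneg _
  by_cases hd : hsDiameter σ N ≤ 0
  · exact (mul_nonpos_of_nonpos_of_nonneg hd hsq).trans (by norm_num)
  · push Not at hd
    rw [lt_div_iff₀ (by positivity)] at hN
    nlinarith

/-- `ε_N² = σ² (N+1)^{1/3} / (N+1)`: the prefactor of `ContactIntensityDomination` is the squared diameter. -/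
theorem hsDiameter_sq_eq (σ : ℝ) (N : ℕ) :
    hsDiameter σ N ^ 2 = σ ^ 2 * ((N + 1 : ℕ) : ℝ) ^ ((1 : ℝ) / 3) / ((N + 1 : ℕ) : ℝ) := by
  have hn : (0 : ℝ) < ((N + 1 : ℕ) : ℝ) := by positivity
  unfold hsDiameter
  rw [mul_pow, ← Real.rpow_natCast (((N + 1 : ℕ) : ℝ) ^ (-(1 / 3 : ℝ))) 2, ← Real.rpow_mul hn.le,
    mul_div_assoc, ← Real.rpow_sub_one hn.ne']
  norm_num

/-- The elementary limit: if `M ≤ A (I + B η)² + D η` for all small `η > 0` then `M ≤ A I²`. -/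
theorem le_of_forall_small {M A I B D h₀ : ℝ} (hh₀ : 0 < h₀)
    (h : ∀ η : ℝ, 0 < η → η ≤ h₀ → M ≤ A * (I + B * η) ^ 2 + D * η) : M ≤ A * I ^ 2 := by
  have hcts : Continuous fun η : ℝ => A * (I + B * η) ^ 2 + D * η := by fun_prop
  have ht : Tendsto (fun η : ℝ => A * (I + B * η) ^ 2 + D * η) (𝓝[>] 0) (𝓝 (A * I ^ 2)) := by
    have := (hcts.tendsto 0).mono_left (nhdsWithin_le_nhds (s := Set.Ioi (0 : ℝ)))
    simpa using this
  refine ge_of_tendsto ht ?_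
  filter_upwards [Ioo_mem_nhdsGT hh₀] with η hη
  exact h η hη.1 hη.2.le

/-- Packaging of the extended-real right-hand side into one `ENNReal.ofReal`. -/
theorem ofReal_pack {c e b n c₁ k s : ℝ} (hc : 0 ≤ c) (he : 0 ≤ e) (hb : 0 ≤ b) (hn : 0 ≤ n)
    (hc₁ : 0 ≤ c₁) (hk : 0 ≤ k) (hs : 0 ≤ s) :
    ENNReal.ofReal c * ENNReal.ofReal e *
        (ENNReal.ofReal b * (ENNReal.ofReal n + ENNReal.ofReal n + 2 * ENNReal.ofReal c₁) ^ 2) +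
      ENNReal.ofReal k * ENNReal.ofReal s =
      ENNReal.ofReal (c * e * (b * (n + n + 2 * c₁) ^ 2) + k * s) := by
  have h2 : (2 : ℝ≥0∞) * ENNReal.ofReal c₁ = ENNReal.ofReal (2 * c₁) := by
    rw [ENNReal.ofReal_mul (by norm_num : (0:ℝ) ≤ 2), ENNReal.ofReal_ofNat]
  rw [h2, ← ENNReal.ofReal_add hn hn, ← ENNReal.ofReal_add (by positivity) (by positivity),
    ← ENNReal.ofReal_pow (by positivity), ← ENNReal.ofReal_mul hb, ← ENNReal.ofReal_mul hc,
    ← ENNReal.ofReal_mul (by positivity), ← ENNReal.ofReal_mul hk,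
    ← ENNReal.ofReal_add (by positivity) (by positivity)]

/-- Smallness bookkeeping for one window: with `η ≤ min (ε/(2(V+1))) (1/(16(V+1)))`, `ε ≤ 1/144` and
`κ = η/ε`, the hypotheses of stubs B and F hold and `η ≤ 1`. -/
theorem window_smallness {ε V η : ℝ} (hε : 0 < ε) (hV1 : 1 ≤ V) (hε144 : ε ≤ 1 / 144)
    (hηε : η ≤ ε / (2 * (V + 1))) (hη16 : η ≤ 1 / (16 * (V + 1))) :
    η ≤ 1 ∧ 2 * (V + 1) * (η / ε) ≤ 1 ∧ ε * (1 + 4 * (η / ε) * (V + 1)) < 1 / 2 := by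
  have hV1' : (0 : ℝ) < V + 1 := by linarith
  refine ⟨?_, ?_, ?_⟩
  · refine hη16.trans ?_
    rw [div_le_one (by positivity)]
    linarith
  · have h2 : 2 * (V + 1) * η ≤ ε := by
      have := mul_le_mul_of_nonneg_left hηε (by positivity : (0 : ℝ) ≤ 2 * (V + 1))
      rwa [mul_div_cancel₀ _ (by positivity : (2 : ℝ) * (V + 1) ≠ 0)] at this
    rw [← mul_div_assoc, div_le_one hε]
    exact h2
  · have h4 : ε * (4 * (η / ε) * (V + 1)) = 4 * η * (V + 1) := by
      field_simp
    have h5 : 4 * η * (V + 1) ≤ 1 / 4 := by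
      have := mul_le_mul_of_nonneg_left hη16 (by positivity : (0 : ℝ) ≤ 4 * (V + 1))
      rw [mul_one_div, show 4 * (V + 1) / (16 * (V + 1)) = 1 / 4 by
        field_simp; ring] at this
      linarith
    rw [mul_add, mul_one, h4]
    linarith

/-- The final contradiction in the reals: the limiting inequality of the windows against the
hot-spot divergence. -/
theorem final_contradiction {c L Nr V E I₁ I₂ : ℝ} (hc : 0 ≤ c) (hL : 1 / 2 ≤ L) (hNr : 1 ≤ Nr)
    (hV : 2 ≤ V) (hE : 0 < E)
    (hlim : (Nr + 1) * Nr * (L * E * (Real.pi * V / 4) * I₂) ≤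
      c * E * (2 * (2 * V + 2)) * (2 * ((Nr + 1) * I₁)) ^ 2)
    (hKV : (384 * c / (Real.pi * L) + 1) * I₁ ^ 2 < I₂) : False := by
  have hπ : 3 < Real.pi := Real.pi_gt_three
  have hI₁sq : 0 ≤ I₁ ^ 2 := sq_nonneg _
  have hLpos : 0 < L := by linarith
  have step1 : Nr * (L * (Real.pi * V / 4) * I₂) ≤ 8 * c * (2 * V + 2) * (Nr + 1) * I₁ ^ 2 := by
    have key : (E * (Nr + 1)) * (Nr * (L * (Real.pi * V / 4) * I₂)) ≤
        (E * (Nr + 1)) * (8 * c * (2 * V + 2) * (Nr + 1) * I₁ ^ 2) := by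
      convert hlim using 1 <;> ring
    exact le_of_mul_le_mul_left key (by positivity)
  have step2 : Nr * (L * (Real.pi * V / 4) * I₂) ≤ (Nr * V) * (48 * c * I₁ ^ 2) := by
    refine step1.trans ?_
    have h6 : (2 * V + 2) * (Nr + 1) ≤ 6 * V * Nr := by nlinarith
    have := mul_le_mul_of_nonneg_left h6 (by positivity : (0 : ℝ) ≤ 8 * c * I₁ ^ 2)
    nlinarith [this]
  have step3 : L * Real.pi * I₂ ≤ 192 * c * I₁ ^ 2 := by
    have key : (Nr * V) * (L * Real.pi * I₂ / 4) ≤ (Nr * V) * (48 * c * I₁ ^ 2) := by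
      convert step2 using 1; ring
    have := le_of_mul_le_mul_left key (by positivity)
    linarith
  have hKV' := mul_lt_mul_of_pos_right hKV (by positivity : (0 : ℝ) < Real.pi * L)
  have hmul : (384 * c / (Real.pi * L) + 1) * I₁ ^ 2 * (Real.pi * L) = (384 * c + Real.pi * L) * I₁ ^ 2 := by
    field_simp
  rw [hmul] at hKV'
  nlinarith [mul_nonneg hc hI₁sq, mul_nonneg hLpos.le hI₁sq]

/-- **`ContactIntensityDomination` is false** (the rung-½ composition; the item-closing statement is
`Summit.AtomisticToContinuum.HydrodynamicLimit.Theorems.not_ContactIntensityDomination` below). -/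
theorem not_contactIntensityDomination :
    ¬ Summit.AtomisticToContinuum.HydrodynamicLimit.Theses.JeansLoadedDice.ContactIntensityDomination := by
  intro hCID
  -- the hot-spot data
  obtain ⟨σ₀, hσ₀, hCID1⟩ := hCID (fun _ => (1 : ℝ)) (fun x => 2 - ‖x‖) (fun _ => (0 : V3))
    continuous_const continuous_thetaHot continuous_const (fun _ => one_pos) thetaHot_pos
  obtain ⟨σ, hσ, hσσ₀, hsd, hlam⟩ := exists_sigma_small hσ₀
  have hσ2 : σ < 1 / 2 := hsd.σ_lt_half
  -- Alexander's flow family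
  have hεp : ∀ N : ℕ, 0 < hsDiameter σ N := fun N => hsDiameter_pos hσ N
  have hε2 : ∀ N : ℕ, hsDiameter σ N < 2⁻¹ := fun N =>
    (hsDiameter_le hσ.le N).trans_lt (by rw [inv_eq_one_div]; exact hσ2)
  let Φ : (N : ℕ) → HardSphereFlow (Torus.geometry (Fin 3)) (hsDiameter σ N) (N + 1) := fun N =>
    (HardSphereFlow.nonempty_torus_holds (d := Fin 3) (hεp N) (hε2 N) (N + 1)).some
  obtain ⟨C, hCtop, N₀, hmain⟩ := hCID1 σ hσ hσσ₀ 1 one_pos Φ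
  clear hCID hCID1
  -- stub C: the Gaussian integrals and the hot-spot divergence
  obtain ⟨hGpos, hGsymm, -, hdiv⟩ := stub_hotSpotDivergence
  have hc0 : 0 ≤ C.toReal := ENNReal.toReal_nonneg
  have hCc : C = ENNReal.ofReal C.toReal := (ENNReal.ofReal_toReal hCtop.ne).symm
  have hlam' : (1 : ℝ) / 2 ≤ 1 - 16 * ovDensity uniformProfile σ := by linarith
  obtain ⟨V₀, hV₀⟩ := hdiv (384 * C.toReal / (Real.pi * (1 - 16 * ovDensity uniformProfile σ)) + 1)
  obtain ⟨V, hVV₀, hV2⟩ : ∃ V : ℝ, V₀ ≤ V ∧ 2 ≤ V := ⟨max V₀ 2, le_max_left _ _, le_max_right _ _⟩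
  have hV1 : 1 ≤ V := by linarith
  have hV1' : (0 : ℝ) < V + 1 := by linarith
  have hKV := hV₀ V hVV₀
  clear hdiv hV₀
  -- the particle number
  obtain ⟨N, hN₀, hN1, hεV⟩ := exists_N_large σ N₀ V
  have hεpos : 0 < hsDiameter σ N := hεp N
  have hε144 : hsDiameter σ N ≤ 1 / 144 := by
    have h9 : (9 : ℝ) ≤ (V + 1) ^ 2 := by nlinarith
    have := mul_le_mul_of_nonneg_left h9 hεpos.le
    linarith
  -- constants of the error terms (stubs D', A)
  obtain ⟨C₁, hC₁, hcoll⟩ :=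
    stub_collisionCountShortTime stub_lawDomination σ hsd 1 one_pos N hN1 (Φ N)
  have hdom := stub_lawDomination σ 1 (0 : V3) (fun x => 2 - ‖x‖) (3 / 2) 2 continuous_thetaHot
    (by norm_num) thetaHot_ge thetaHot_le one_pos N (Φ N)
  -- abbreviations (reals): the two Gaussian integrals of the profile
  obtain ⟨I₁, hI₁⟩ : ∃ I₁ : ℝ, I₁ = ∫ x : T3, ∫ v, max 0 (1 - ‖v - V • EuclideanSpace.single (0 : Fin 3) (1 : ℝ)‖)
      ∂gaussMeasure (0 : V3) (2 - ‖x‖) := ⟨_, rfl⟩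
  obtain ⟨I₂, hI₂⟩ : ∃ I₂ : ℝ, I₂ = ∫ x : T3, (∫ v, max 0 (1 - ‖v - V • EuclideanSpace.single (0 : Fin 3) (1 : ℝ)‖)
      ∂gaussMeasure (0 : V3) (2 - ‖x‖)) ^ 2 := ⟨_, rfl⟩
  rw [← hI₁, ← hI₂] at hKV
  have hI₁0 : 0 ≤ I₁ := by
    rw [hI₁]
    exact integral_nonneg fun x => integral_nonneg fun v => le_max_left _ _
  have hI₁' : (∫ x : T3, ∫ v, max 0 (1 - ‖v + V • EuclideanSpace.single (0 : Fin 3) (1 : ℝ)‖)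
      ∂gaussMeasure (0 : V3) (2 - ‖x‖)) = I₁ := by
    rw [hI₁]
    exact integral_congr_ae (Eventually.of_forall fun x => hGsymm V _ (thetaHot_pos x))
  have hGG : (∫ x : T3, (∫ v, max 0 (1 - ‖v - V • EuclideanSpace.single (0 : Fin 3) (1 : ℝ)‖)
      ∂gaussMeasure (0 : V3) (2 - ‖x‖)) *
      (∫ v, max 0 (1 - ‖v + V • EuclideanSpace.single (0 : Fin 3) (1 : ℝ)‖)
        ∂gaussMeasure (0 : V3) (2 - ‖x‖))) = I₂ := by
    rw [hI₂]
    refine integral_congr_ae (Eventually.of_forall fun x => ?_)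
    simp only
    rw [hGsymm V _ (thetaHot_pos x), sq]
  -- the window threshold
  obtain ⟨h₀, hh₀def⟩ : ∃ h₀ : ℝ, h₀ = min (hsDiameter σ N / (2 * (V + 1))) (1 / (16 * (V + 1))) := ⟨_, rfl⟩
  have hh₀ : 0 < h₀ := by rw [hh₀def]; exact lt_min (by positivity) (by positivity)
  -- THE KEY INEQUALITY on every small window
  have hkey : ∀ η : ℝ, 0 < η → η ≤ h₀ →
      ((N + 1 : ℕ) : ℝ) * N * ((1 - 16 * ovDensity uniformProfile σ) * hsDiameter σ N ^ 2 *
          (Real.pi * V / 4) * I₂) ≤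
        (C.toReal * hsDiameter σ N ^ 2 * (2 * (2 * V + 2))) *
            (2 * (((N + 1 : ℕ) : ℝ) * I₁) + (2 * C₁) * η) ^ 2 +
          ((((2 : ℝ) / (3 / 2)) ^ ((3 : ℝ) / 2)) ^ (N + 1) *
              (((((N + 1 : ℕ) : ℝ)) ^ 7 + (((N + 1 : ℕ) : ℝ)) ^ 8) *
                (1024 * hsDiameter σ N ^ 4 * (‖(0 : V3)‖ ^ 2 + 3 * 2)))) * η := by
    intro η hη hηh₀
    -- smallness bookkeeping
    have hηε : η ≤ hsDiameter σ N / (2 * (V + 1)) := hηh₀.trans (hh₀def ▸ min_le_left _ _)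
    have hη16 : η ≤ 1 / (16 * (V + 1)) := hηh₀.trans (hh₀def ▸ min_le_right _ _)
    obtain ⟨hη1, hκ1, hcondF⟩ := window_smallness hεpos hV1 hε144 hηε hη16
    obtain ⟨κ, hκdef⟩ : ∃ κ : ℝ, κ = η / hsDiameter σ N := ⟨_, rfl⟩
    rw [← hκdef] at hκ1 hcondF
    have hκpos : 0 < κ := by rw [hκdef]; exact div_pos hη hεpos
    have hκε : κ * hsDiameter σ N = η := by rw [hκdef]; exact div_mul_cancel₀ η hεpos.ne'
    -- (1) ContactIntensityDomination for the marks φ_V on the window (0, η]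
    have hφc : Continuous fun p : V3 × V3 => ENNReal.ofReal
        (max 0 (1 - ‖p.1 - V • EuclideanSpace.single (0 : Fin 3) (1 : ℝ)‖) *
            max 0 (1 - ‖p.2 + V • EuclideanSpace.single (0 : Fin 3) (1 : ℝ)‖) +
          max 0 (1 - ‖p.2 - V • EuclideanSpace.single (0 : Fin 3) (1 : ℝ)‖) *
            max 0 (1 - ‖p.1 + V • EuclideanSpace.single (0 : Fin 3) (1 : ℝ)‖)) :=
      ENNReal.continuous_ofReal.comp (by fun_prop)
    have h1 := hmain N hN₀ 0 η le_rfl hη.le hη1 _ hφc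
    simp only [] at h1
    -- (2) the main term (stub B)
    have hB := stub_tubeMeanLower σ hsd 1 one_pos N (Φ N) V κ hV2 hκpos.le hκ1 hεV
    rw [hGG] at hB
    -- (3) the right-hand side (stub D) and the collision count (stub D')
    have hD := stub_rhsShortTime σ hσ hσ2 1 one_pos N (Φ N) V η hV1 hη
    rw [← hI₁, hI₁'] at hD
    have hX := hcoll η hη
    -- (4) the measurable majorant of the pair excess (rung-0 statics + domination, stub A)
    obtain ⟨M, hMm, hMdom, hMint⟩ := EnergyCurrentTailsLevelCensus.splitFloorRung0_statics σ hσ hσ2.le hsd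
      1 2 one_pos two_pos (0 : V3) N (Φ N) η hη
    have hMint' : ∫⁻ w, M w ∂(localGibbsLaw σ (fun _ => (1 : ℝ)) (fun _ => (0 : V3)) (fun x => 2 - ‖x‖) N (Φ N)) ≤
        ENNReal.ofReal ((((2 : ℝ) / (3 / 2)) ^ ((3 : ℝ) / 2)) ^ (N + 1)) *
          ENNReal.ofReal (((((N + 1 : ℕ) : ℝ)) ^ 7 + (((N + 1 : ℕ) : ℝ)) ^ 8) *
            (1024 * hsDiameter σ N ^ 4 * (‖(0 : V3)‖ ^ 2 + 3 * 2) * η ^ 2)) := by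
      calc ∫⁻ w, M w ∂(localGibbsLaw σ (fun _ => (1 : ℝ)) (fun _ => (0 : V3)) (fun x => 2 - ‖x‖) N (Φ N))
          ≤ ∫⁻ w, M w ∂(ENNReal.ofReal ((((2 : ℝ) / (3 / 2)) ^ ((3 : ℝ) / 2)) ^ (N + 1)) •
              localGibbsLaw σ (fun _ => (1 : ℝ)) (fun _ => (0 : V3)) (fun _ => (2 : ℝ)) N (Φ N)) :=
            lintegral_mono' hdom le_rfl
        _ = ENNReal.ofReal ((((2 : ℝ) / (3 / 2)) ^ ((3 : ℝ) / 2)) ^ (N + 1)) *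
              ∫⁻ w, M w ∂(localGibbsLaw σ (fun _ => (1 : ℝ)) (fun _ => (0 : V3)) (fun _ => (2 : ℝ)) N (Φ N)) := by
            rw [lintegral_smul_measure, smul_eq_mul]
        _ ≤ _ := mul_le_mul_right hMint _
    -- (5) the pathwise lower bound (stub F), integrated on the good set
    have hT : (∫⁻ z, ENNReal.ofReal (∑ i : Fin (N + 1), ∑ j : Fin (N + 1), (if i ≠ j then pairTubeMark (hsDiameter σ N) κ (fun q : V3 × V3 × V3 => max 0 (1 - ‖q.2.1 - V • EuclideanSpace.single (0 : Fin 3) (1 : ℝ)‖) * max 0 (1 - ‖q.2.2 + V • EuclideanSpace.single (0 : Fin 3) (1 : ℝ)‖)) i j (fun m => (z m).1) (fun m => (z m).2) else 0)) ∂(localGibbsLaw σ (fun _ => (1 : ℝ)) (fun _ => (0 : V3)) (fun x => 2 - ‖x‖) N (Φ N))) ≤ (∫⁻ z, (∑ᶠ τ ∈ collisionTimes (Torus.geometry (Fin 3)) (hsDiameter σ N) (fun r => (Φ N).flow r z) ∩ Set.Ioc 0 η, ∑ i : Fin (N + 1), ∑ j : Fin (N + 1), if i = j then (0 : ℝ≥0∞)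 else (contactSet (Torus.geometry (Fin 3)) (N + 1) (hsDiameter σ N) i j).indicator (fun y => ENNReal.ofReal (max 0 (1 - ‖((collidePair (Torus.geometry (Fin 3)) i j y) i).2 - V • EuclideanSpace.single (0 : Fin 3) (1 : ℝ)‖) * max 0 (1 - ‖((collidePair (Torus.geometry (Fin 3)) i j y) j).2 + V • EuclideanSpace.single (0 : Fin 3) (1 : ℝ)‖) + max 0 (1 - ‖((collidePair (Torus.geometry (Fin 3)) i j y) j).2 - V • EuclideanSpace.single (0 : Fin 3) (1 : ℝ)‖) * max 0 (1 - ‖((collidePair (Torus.geometry (Fin 3)) i j y) i).2 + V • EuclideanSpace.single (0 : Fin 3) (1 : ℝ)‖))) ((Φ N).flow τ z)) ∂(localGibbsLaw σ (fun _ => (1 : ℝ)) (fun _ => (0 : V3)) (fun x => 2 - ‖x‖) N (Φ N))) + ∫⁻ z, M z ∂(localGibbsLaw σ (fun _ => (1 : ℝ)) (fun _ => (0 : V3)) (fun x => 2 - ‖x‖) N (Φ N)) := by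
      rw [← lintegral_add_right _ hMm]
      refine lintegral_mono_ae ?_
      filter_upwards [ae_mem_good_localGibbsLaw σ (fun _ => (1 : ℝ)) (fun _ => (0 : V3)) (fun x => 2 - ‖x‖) N (Φ N)]
        with z hz
      have hF := stub_pathwiseLower σ hσ hσ2 N (Φ N) z hz 0 V κ hV1 hκpos hcondF
      rw [(Φ N).flow_zero z hz, zero_add, hκε] at hF
      exact hF.trans (add_le_add le_rfl (hMdom z ((Φ N).good_subset hz)))
    -- (6) the chain in `ℝ≥0∞`
    have hD' := hD.trans (mul_le_mul_right (pow_le_pow_left' (add_le_add le_rfl (mul_le_mul_right hX 2)) 2) _)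
    have hchain := calc _ ≤ _ := hB
      _ ≤ _ := hT
      _ ≤ _ := add_le_add (h1.trans (mul_le_mul_right hD' _)) hMint'
    rw [hCc, ← hsDiameter_sq_eq σ N, ofReal_pack hc0 (by positivity) (by positivity) (by positivity)
      (by positivity) (by positivity) (by positivity)] at hchain
    have hreal := (ENNReal.ofReal_le_ofReal_iff (by positivity)).1 hchain
    -- (7) back to the reals: divide by `η`
    refine le_of_mul_le_mul_right ?_ hη
    have hL : ((N + 1 : ℕ) : ℝ) * N * ((1 - 16 * ovDensity uniformProfile σ) * hsDiameter σ N ^ 3 * κ *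
        (Real.pi * V / 4) * I₂) = ((N + 1 : ℕ) : ℝ) * N * ((1 - 16 * ovDensity uniformProfile σ) *
          hsDiameter σ N ^ 2 * (Real.pi * V / 4) * I₂) * η := by
      linear_combination (((N + 1 : ℕ) : ℝ) * N * (1 - 16 * ovDensity uniformProfile σ) *
        (Real.pi * V / 4) * I₂ * hsDiameter σ N ^ 2) * hκε
    rw [hL] at hreal
    refine hreal.trans (le_of_eq ?_)
    ring
  have hlim := le_of_forall_small hh₀ hkey
  -- the contradiction with the hot-spot divergence
  have hNr : (1 : ℝ) ≤ N := by exact_mod_cast hN1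
  push_cast at hlim
  exact final_contradiction hc0 hlam' hNr hV2 (pow_pos hεpos 2) hlim hKV

end Assembly

end Summit.AtomisticToContinuum.HydrodynamicLimit.Theorems.EnergyCurrentTailsRungHalf

namespace Summit.AtomisticToContinuum.HydrodynamicLimit.Theorems

/-- Refutes `JeansLoadedDice.ContactIntensityDomination` (stmt-AtomisticToContinuum-9218) [refuted-misstated]: the mark-uniform
one-sided Stosszahlansatz ceiling with the PRODUCT OF TWO INDEPENDENT COPIES (spatially averaged marginals) on the right is false
for inhomogeneous local Gibbs data already as `t → 0+`.  Witness: `a₀ ≡ 1`, `u₀ ≡ 0`, `θ₀ x = 2 − ‖x‖` (hot spot at `0`),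
marks `φ_V = β(· − Ve₁)⊗β(· + Ve₁) + swap`, `V → ∞`, window `(0, h]`, `h → 0`: LHS `∝ ∫ G_V(θ₀ x)² dx`, RHS `∝ (∫ G_V(θ₀ x) dx)²`.
Repaired statement C′ (typed: `Cruxes/EnergyCurrentTails/Lines/level_census_comparison_local_ceiling.lean`, `ContactIntensityDominationLocal` /
`ContactIntensityDominationOneRare`): the LOCAL (one-copy, mollified Enskog pair functional) form, or the restriction to one-rare-participant marks;
the witness misses C′ (its two participants are both rare and the local form carries the same hot-spot factor on both sides). -/
theorem not_ContactIntensityDomination :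
    ¬ Summit.AtomisticToContinuum.HydrodynamicLimit.Theses.JeansLoadedDice.ContactIntensityDomination :=
  EnergyCurrentTailsRungHalf.not_contactIntensityDomination

/-- The textually identical copy `SpeedCapSurgery.ContactIntensityDomination` (same item stmt-AtomisticToContinuum-9218, wanted as a
support by route SpeedCapSurgery) is false for the same reason (the two `Prop`s are definitionally equal). -/
theorem not_SpeedCapSurgery_ContactIntensityDomination :
    ¬ Summit.AtomisticToContinuum.HydrodynamicLimit.Theses.SpeedCapSurgery.ContactIntensityDomination :=
  fun h => EnergyCurrentTailsRungHalf.not_contactIntensityDomination h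

end Summit.AtomisticToContinuum.HydrodynamicLimit.Theorems

end
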